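import Mathlib
import Summits.ValiantsHypothesis.ValiantsHypothesis.Theorems.DivisionGapPerCofactorDegreeReductionStubNegativeCompensation
import Summits.ValiantsHypothesis.ValiantsHypothesis.Theorems.DivisionGapPerCofactorDegreeReductionStubPositivityThreshold

/-!
# Crux `DivisionGap.PerCofactorDegreeReduction` (stmt-ValiantsHypothesis-15046), line `Sketch` —
# stub `stub_negativeCapable`: which monomials can carry a negative coefficient of a cofactor

**Theorem (`stub_negativeCapable`).** Let `m` be an exponent in the `n × n` variables `x_ij`.
There is a real `q ∈ ℝ[x_ij]` with `q_m < 0` and every coefficient of `per_n · q` nonnegative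
if and only if against EVERY permutation `σ` there is a second permutation `ρ ≠ σ` with
`μ_ρ ≤ m + μ_σ`.

## Proof

* (⇒) is the landed `NegativeCompensation.stub_negativeCompensation`: a negative coefficient
  `q_m < 0` of a cofactor with `per_n · q ≥ 0` is compensated, against every `σ`, by a second
  permutation `τ ≠ σ` with `μ_τ ≤ m + μ_σ` (and `q_{m + μ_σ − μ_τ} > 0`, which we drop).
* (⇐) chooses `ρ(σ)` for every `σ` (`Classical.choice` via `choose`) and feeds the self-map `ρ`
  to the landed engine `PositivityThreshold.exists_signed_cofactor`, which returns
  `q := Σ_σ x^{(m + μ_σ) − μ_{ρ(σ)}} − x^m` with `coeff m q = −1 < 0` and `per_n · q ≥ 0`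
  coefficientwise.

This is the finite, circuit-free object the K2 window is about (lemma N0 of the K2 probe).

Design: no definitions; everything over `Fin n` for all `n`.  Leans on Mathlib and the two landed
stub files `DivisionGapPerCofactorDegreeReductionStubNegativeCompensation.lean`
(`stub_negativeCompensation`) and
`DivisionGapPerCofactorDegreeReductionStubPositivityThreshold.lean` (`exists_signed_cofactor`).
-/

noncomputable section

-- `Summit.ValiantsHypothesis.ValiantsHypothesis.…` is the tree's mandated single-conjunct layout
-- (Problem = Summit), so the duplicated namespace component is intended.
set_option linter.dupNamespace false

namespace Summit.ValiantsHypothesis.ValiantsHypothesis.Theorems.DivisionGap.PerCofactorDegreeReduction.NegativeCapable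

open MvPolynomial Literature.Computability.AlgebraicComplexity
open scoped BigOperators

/-! ### The stub -/

/-- **stub_negativeCapable — which monomials can carry a negative coefficient of a cofactor.**
An exponent `m` is the exponent of a negative coefficient of some real `q` with `per_n · q ≥ 0`
coefficientwise iff against EVERY permutation `σ` there is a second permutation `ρ ≠ σ` with
`μ_ρ ≤ m + μ_σ`.  (⇒) is `NegativeCompensation.stub_negativeCompensation`; (⇐) chooses `ρ(σ)`
and applies the engine `PositivityThreshold.exists_signed_cofactor`
(`q := Σ_σ x^{(m + μ_σ) − μ_{ρ(σ)}} − x^m`, `coeff m q = −1`).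
[prime-walk-positivizer, K2 window] -/
theorem stub_negativeCapable (n : ℕ) (m : (Fin n × Fin n) →₀ ℕ) :
    (∃ q : MvPolynomial (Fin n × Fin n) ℝ,
        coeff m q < 0 ∧ ∀ d, 0 ≤ coeff d (perPoly (Fin n) ℝ * q)) ↔
    ∀ σ : Equiv.Perm (Fin n), ∃ ρ : Equiv.Perm (Fin n),
      ρ ≠ σ ∧ permMonomial ρ ≤ m + permMonomial σ := by
  constructor
  · -- (⇒): a negative coefficient must be compensated against every `σ`
    rintro ⟨q, hm, hpos⟩ σ
    obtain ⟨τ, hτσ, hle, -⟩ :=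
      NegativeCompensation.stub_negativeCompensation n q hpos m hm σ
    exact ⟨τ, hτσ, hle⟩
  · -- (⇐): choose the second permutation `ρ(σ)` and run the engine
    intro h
    choose ρ hρne hρle using h
    obtain ⟨q, -, hqm, hpos⟩ := PositivityThreshold.exists_signed_cofactor m ρ hρne hρle
    exact ⟨q, by rw [hqm]; norm_num, hpos⟩

end Summit.ValiantsHypothesis.ValiantsHypothesis.Theorems.DivisionGap.PerCofactorDegreeReduction.NegativeCapable

end
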